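import Literature.NumberTheory.GaloisRepresentations.HasseArfCyclicBasic
import HarnessLib

/-!
# Hasse–Arf for cyclic groups, III: the different exponent of a prime fixed by the whole group
(Serre, *Local Fields*, Ch. IV §1 Prop. 4 over the base ring, and the integer inequalities of Ch. V)

Third file of the series proving Serre's Prop. V.11 in the global Dedekind setting
(`HasseArfCyclicBasic.lean`).  The trace estimates of `HasseArfCyclicTrace.lean` are governed by
the exponent `d = v_𝔓(𝔇_{S/R})` of the different of `S = integralClosure R L` over `R` at the
totally ramified prime `𝔓`.  The tree proves Hilbert's formula
`v_𝔓(𝔇_{S_L/S_F}) = Σ_{s ∈ Gal(L/F), s ≠ 1} i_G(s)` over the integral closure `S_F` of an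
intermediate field (`emultiplicity_differentIdeal_eq_finsum_lowerIndex`,
`ArtinRepresentationDifferentProofs.lean`); here we need it over the base ring `R` itself, for a
prime fixed by all of `G` (which is the case at a totally ramified prime):

* `Literature.NumberTheory.GaloisRepresentations.emultiplicity_differentIdeal_base_eq_finsum_lowerIndex`
  — **`v_𝔓(𝔇_{S/R}) = Σ_{s ≠ 1} i_G(s)`** when every `g ∈ G` fixes `𝔓` (Serre IV §1 Prop. 4;
  the tree's proof, run with `R` in place of `S_F`: a generator `x` with `d S ⊆ R[x]`, `d ∉ 𝔓`,
  Ch. III §6 Prop. 12, `i_G(s) = v_𝔓(s x - x)`, Euler's `𝔯 𝔇 = (f'(x))`);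
* `…finsum_lowerIndex_ne_one_add_eq_sum_card`, `…finsum_lowerIndex_subgroup_ne_one_add_eq_sum_card`
  — the layer-cake identities **`Σ_{s ≠ 1} i_G(s) + (m + 1) = Σ_{i=0}^{m} |G_i|`** and, for a
  subgroup `H` with its induced filtration, `Σ_{s ∈ H, s ≠ 1} i_G(s) + (m + 1) = Σ_{i=0}^{m} |H_i|`,
  for `m` with `G_{m+1} = 1` (Serre IV §1 Prop. 4, second form `Σ_{i} (|G_i| - 1)`, via the tree's
  Lemma IV.3.3 `finsum_min_lowerIndex`);
* `…sub_add_mul_le_sum_sub_add_mul`, `…le_sum_sub_of_chain` — the two **integer inequalities**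
  that replace Herbrand's transitivity `ψ_{L/K} = ψ_{L/K'} ∘ ψ_{K'/K}` in Serre's dévissage
  (Ch. V §6): with `g_i = |G_i|`, `h_i = |H ∩ G_i|`, `r = g_0`, `h = h_0` and
  `Σ_{i=1}^{m} g_i = r n` (i.e. `m = ψ(n)`):
  `r - h + r n ≤ Σ_{i=0}^{m} (g_i - h_i) + h m` always, and, when `m` exceeds the last jump `μ`
  and `1 < h < r`, `h ≤ Σ_{i=1}^{m} (h - h_i)` (the case `m = μ + 1`, `H ≤ G_μ` being excluded by
  `g_μ ∣ Σ_{i ≤ μ} g_i`, `g_μ ∣ r`, `g_μ ∤ 1`).  These are pure statements about antitone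
  sequences of natural numbers with the divisibilities of a subgroup chain.

## References

* J.-P. Serre, *Local Fields*, GTM 67, Springer 1979: Ch. III §6 Prop. 11–12; Ch. IV §1 Prop. 2,
  Prop. 4; Ch. IV §3 Prop. 13 and Prop. 15; Ch. V §6 (proof of Prop. 8–9 by dévissage).
  [SerreLocalFields1979]
-/

open Polynomial

noncomputable section

open scoped Pointwise

namespace Literature.NumberTheory.GaloisRepresentations

/-! ### Hilbert's different formula over the base ring at a prime fixed by the group -/

section HilbertBase

attribute [local instance] FractionRing.liftAlgebra FractionRing.isScalarTower_liftAlgebra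

variable (R : Type*) {K L : Type*} [CommRing R] [IsDedekindDomain R] [Field K] [Field L]
  [Algebra R K] [IsFractionRing R K] [Algebra R L] [Algebra K L] [IsScalarTower R K L]
  [FiniteDimensional K L] [IsGalois K L]

/-- **Hilbert's different formula over the base ring** (Serre, Ch. IV §1, Prop. 4:
`v_L(𝔇_{L/K}) = Σ_{s ≠ 1} i_G(s)`, global form of Remark 2): for `R` Dedekind with fraction field
`K`, `L/K` finite Galois with group `G`, and a maximal ideal `𝔓 ≠ 0` of `S = integralClosure R L`
with separable residue extension which is fixed by every `g ∈ G` (e.g. totally ramified), the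
exponent of `𝔓` in `differentIdeal R S` is `Σ_{s ≠ 1} i_G(s)`.  The proof is the tree's proof of
`emultiplicity_differentIdeal_eq_finsum_lowerIndex` (there over `S_F`), with `R` as base: Ch. III
§6 Prop. 12 (`exists_generator_smul_mem_adjoin`) gives `x ∈ S`, `d ∈ R ∖ 𝔓` with `d S ⊆ R[x]`, so
`i_G(s) = v_𝔓(s x - x)` (`lowerIndex_eq_ordIdeal`), the minimal polynomial of `x` over `R` is
`∏_s (X - s x)`, `x` generates `L/K`, and `𝔯 𝔇_{S/R} = (f'(x))` with `𝔯 ∌ 𝔓`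
(Mathlib's `conductor_mul_differentIdeal`).
Ref: Serre, *Local Fields*, Ch. IV §1, Prop. 4 and Remark 2; Ch. III §6, Prop. 11–12.
[cite: SerreLocalFields1979, Ch. IV §1 Prop. 4] -/
theorem emultiplicity_differentIdeal_base_eq_finsum_lowerIndex
    [IsDedekindDomain (integralClosure R L)] [Module.IsTorsionFree R (integralClosure R L)]
    (𝔓 : Ideal (integralClosure R L)) [𝔓.IsMaximal]
    (h𝔓 : 𝔓 ≠ ⊥) [Algebra.IsSeparable (R ⧸ 𝔓.under R) (integralClosure R L ⧸ 𝔓)]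
    (hstab : ∀ g : L ≃ₐ[K] L, g • 𝔓 = 𝔓) :
    emultiplicity 𝔓 (differentIdeal R (integralClosure R L)) =
      ∑ᶠ (s : L ≃ₐ[K] L) (_ : s ≠ 1), lowerIndex 𝔓 (L ≃ₐ[K] L) s := by
  classical
  haveI : FaithfulSMul (L ≃ₐ[K] L) (integralClosure R L) := faithfulSMul_algEquiv_integralClosure R
  haveI : IsFractionRing (integralClosure R L) L :=
    integralClosure.isFractionRing_of_finite_extension K L
  haveI : Module.Finite R (integralClosure R L) :=
    IsIntegralClosure.finite R K L (integralClosure R L)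
  haveI : Algebra.IsSeparable K L := IsGalois.to_isSeparable
  haveI : Algebra.IsInvariant R (integralClosure R L) (L ≃ₐ[K] L) := isInvariant_integralClosure R
  haveI h𝔓prime : 𝔓.IsPrime := Ideal.IsMaximal.isPrime inferInstance
  have hprime : Prime 𝔓 := Ideal.prime_of_isPrime h𝔓 inferInstance
  -- Serre III §6 Prop. 12 (global form) and Lemma IV.1.1: a generator `x` with
  -- `i_G(g) = v_𝔓(g x - x)`
  obtain ⟨x, d, hd, hgen⟩ :=
    exists_generator_smul_mem_adjoin (A := R) (L ≃ₐ[K] L) 𝔓 h𝔓 hstab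
  have hi : ∀ g : L ≃ₐ[K] L, lowerIndex 𝔓 (L ≃ₐ[K] L) g = ordIdeal 𝔓 (g • x - x) :=
    lowerIndex_eq_ordIdeal h𝔓 hstab hd hgen
  obtain ⟨Nb, hNb⟩ := Ideal.ramificationSubgroup_eventually_eq_bot_holds 𝔓 (L ≃ₐ[K] L)
    (Ideal.IsMaximal.ne_top inferInstance)
  have hne1 : ∀ g : L ≃ₐ[K] L, g ≠ 1 → g • x ≠ x := fun g hg h => by
    refine lowerIndex_ne_top 𝔓 (hNb Nb le_rfl) hg ?_
    rw [hi g, h, sub_self, ordIdeal_zero]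
  have hinj : Function.Injective fun g : L ≃ₐ[K] L => g • x := by
    intro g₁ g₂ h
    have : (g₂⁻¹ * g₁) • x = x := by rw [mul_smul, show g₁ • x = g₂ • x from h, inv_smul_smul]
    by_contra hne
    exact hne1 (g₂⁻¹ * g₁) (fun h' => hne (inv_mul_eq_one.mp h').symm) this
  -- the polynomial `Q = ∏_{g ∈ G} (X - g x)` is the minimal polynomial of `x` over `R`
  set Q : (integralClosure R L)[X] := ∏ g : L ≃ₐ[K] L, (X - C (g • x)) with hQ
  have hQmonic : Q.Monic := monic_prod_of_monic _ _ fun g _ => monic_X_sub_C _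
  have hQdeg : Q.natDegree = Fintype.card (L ≃ₐ[K] L) := by
    rw [hQ, natDegree_prod_of_monic _ _ fun g _ => monic_X_sub_C _]
    simp
  have hxint : IsIntegral R x := Algebra.IsIntegral.isIntegral x
  set P := minpoly R x with hP
  have hPmonic : P.Monic := minpoly.monic hxint
  have hQeq : Q = (Multiset.map (fun a => X - C a)
      ((Finset.univ : Finset (L ≃ₐ[K] L)).val.map fun g => g • x)).prod := by
    rw [hQ, Finset.prod_eq_multiset_prod, Multiset.map_map]; rfl
  have hdvd : Q ∣ P.map (algebraMap R (integralClosure R L)) := by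
    rw [hQeq, Multiset.prod_X_sub_C_dvd_iff_le_roots (hPmonic.map _).ne_zero,
      Multiset.le_iff_subset ((Finset.univ : Finset (L ≃ₐ[K] L)).nodup.map hinj)]
    intro a ha
    obtain ⟨g, -, rfl⟩ := Multiset.mem_map.mp ha
    rw [mem_roots (hPmonic.map _).ne_zero, IsRoot.def, eval_map_algebraMap, ← smul_aeval, hP,
      minpoly.aeval, smul_zero]
  have hfin : Module.finrank K L = Fintype.card (L ≃ₐ[K] L) := by
    rw [← Nat.card_eq_fintype_card]; exact (IsGalois.card_aut_eq_finrank K L).symm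
  have hPx : minpoly K (x : L) = P.map (algebraMap R K) := by
    rw [hP, ← minpoly.algebraMap_eq (FaithfulSMul.algebraMap_injective (integralClosure R L) L) x]
    exact minpoly.isIntegrallyClosed_eq_field_fractions' K hxint.algebraMap
  have hdegP : P.natDegree ≤ Fintype.card (L ≃ₐ[K] L) := by
    have h1 : (minpoly K (x : L)).natDegree ≤ Module.finrank K L := minpoly.natDegree_le (x : L)
    rwa [hPx, hPmonic.natDegree_map, hfin] at h1
  have hPQ : P.map (algebraMap R (integralClosure R L)) = Q :=
    eq_of_monic_of_dvd_of_natDegree_le hQmonic (hPmonic.map _) hdvd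
      (by rw [hPmonic.natDegree_map, hQdeg]; exact hdegP)
  -- hence `x` generates `L/K`
  have hx : Algebra.adjoin K {((x : integralClosure R L) : L)} = ⊤ := by
    have hdeg : (minpoly K (x : L)).natDegree = Module.finrank K L := by
      rw [hPx, hPmonic.natDegree_map, hfin, ← hQdeg, ← hPQ, hPmonic.natDegree_map]
    have htop := (Field.primitive_element_iff_minpoly_natDegree_eq K (x : L)).mpr hdeg
    have halg : IsAlgebraic K (x : L) := Algebra.IsAlgebraic.isAlgebraic _
    rw [← IntermediateField.adjoin_simple_toSubalgebra_of_isAlgebraic halg, htop,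
      IntermediateField.top_toSubalgebra]
  -- Euler: `𝔣 · 𝔇_{S/R} = (P'(x))`, and `𝔣` is prime to `𝔓` (`d ∈ 𝔣`, `d ∉ 𝔓`)
  have hEuler := conductor_mul_differentIdeal R K L x hx
  have hcond : emultiplicity 𝔓 (conductor R x) = 0 := by
    rw [emultiplicity_eq_zero, Ideal.dvd_iff_le]
    intro hle
    refine hd (hle ?_)
    rw [mem_conductor_iff]
    intro b
    obtain ⟨Pb, hPb⟩ := hgen b
    rw [← Algebra.smul_def, hPb]
    exact aeval_mem_adjoin_singleton _ x
  have hmul := congrArg (emultiplicity 𝔓) hEuler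
  rw [emultiplicity_mul hprime, hcond, zero_add] at hmul
  -- `P'(x) = ∏_{g ≠ 1} (x - g x)`
  have hder : aeval x (derivative P) =
      ∏ g ∈ (Finset.univ : Finset (L ≃ₐ[K] L)).erase 1, (x - g • x) := by
    rw [← eval_map_algebraMap, ← derivative_map, hPQ, hQeq]
    have hxmem : x ∈ (Finset.univ : Finset (L ≃ₐ[K] L)).val.map fun g => g • x :=
      Multiset.mem_map.mpr ⟨1, Finset.mem_univ_val _, one_smul _ _⟩
    rw [eval_multiset_prod_X_sub_C_derivative hxmem]
    have herase : ((Finset.univ : Finset (L ≃ₐ[K] L)).val.map fun g => g • x).erase x =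
        ((Finset.univ : Finset (L ≃ₐ[K] L)).erase 1).val.map fun g => g • x := by
      rw [Finset.erase_val, Multiset.map_erase _ hinj, one_smul]
    rw [herase, Finset.prod_eq_multiset_prod, Multiset.map_map]
    rfl
  rw [hmul, hder, ordIdeal_prod h𝔓]
  -- both sides are `Σ_{g ≠ 1} i(g)`
  rw [finsum_cond_eq_sum_of_cond_iff (t := (Finset.univ : Finset (L ≃ₐ[K] L)).erase 1) _
      (fun {s} _ => ?_)]
  · refine Finset.sum_congr rfl fun g _ => ?_
    rw [ordIdeal_sub_comm, ← hi g]
  · rw [Finset.mem_erase]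
    exact ⟨fun hs => ⟨hs, Finset.mem_univ _⟩, fun hs => hs.1⟩

end HilbertBase

/-! ### Layer-cake: `Σ_{s ≠ 1} i_G(s) + (m+1) = Σ_{i=0}^{m} |G_i|` -/

section LayerCake

variable {S : Type*} [CommRing S] (𝔓 : Ideal S) {G : Type*} [Group G] [MulSemiringAction G S]
  [Finite G]

/-- **The different exponent as a sum over the filtration**: if `G_{m+1} = 1` then
`Σ_{s ≠ 1} i_G(s) + (m + 1) = Σ_{i=0}^{m} |G_i|` (Lemma IV.3.3 at integers,
`Σ_{s} inf(i_G(s), m+1) = Σ_{i ≤ m} |G_i|`, where `inf(i_G(s), m+1) = i_G(s)` for `s ≠ 1` and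
`= m + 1` for `s = 1`).  This is Serre's second form `v(𝔇) = Σ_i (|G_i| - 1)` of Hilbert's formula.
Ref: Serre, *Local Fields*, Ch. IV §1, Prop. 4 (second form); Ch. IV §3, Lemma 3.
[cite: SerreLocalFields1979, Ch. IV §1 Prop. 4] -/
theorem finsum_lowerIndex_ne_one_add_eq_sum_card {m : ℕ} (hm : 𝔓.ramificationSubgroup G (m + 1) = ⊥) :
    (∑ᶠ (s : G) (_ : s ≠ 1), lowerIndex 𝔓 G s) + (m + 1 : ℕ) =
      ((∑ i ∈ Finset.range (m + 1), Nat.card (𝔓.ramificationSubgroup G i) : ℕ) : ℕ∞) := by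
  classical
  haveI : Fintype G := Fintype.ofFinite G
  have key := finsum_min_lowerIndex 𝔓 (G := G) m
  rw [finsum_eq_sum_of_fintype, ← Finset.add_sum_erase _ _ (Finset.mem_univ (1 : G)),
    lowerIndex_one, min_eq_right le_top, add_comm] at key
  rw [← key, finsum_cond_eq_sum_of_cond_iff (t := (Finset.univ : Finset G).erase 1) _
      (fun {s} _ => by rw [Finset.mem_erase]; exact ⟨fun h => ⟨h, Finset.mem_univ _⟩, fun h => h.1⟩)]
  push_cast
  congr 1
  refine Finset.sum_congr rfl fun s hs => ?_
  have hs1 : s ≠ 1 := (Finset.mem_erase.mp hs).1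
  refine (min_eq_left ?_).symm
  rw [← Nat.cast_one, ← Nat.cast_add, lowerIndex_le_natCast_iff, hm]
  exact fun h => hs1 (Subgroup.mem_bot.mp h)

/-- The same for a subgroup `H ≤ G` with its induced filtration `H_i = H ∩ G_i` (Prop. IV.2,
`i_H = i_G` on `H`): if `G_{m+1} = 1` then
`Σ_{s ∈ H, s ≠ 1} i_G(s) + (m + 1) = Σ_{i=0}^{m} |H_i|`.
Ref: Serre, *Local Fields*, Ch. IV §1, Prop. 2 and Prop. 4. [cite: SerreLocalFields1979, Ch. IV §1 Prop. 2 and Prop. 4] -/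
theorem finsum_lowerIndex_subgroup_ne_one_add_eq_sum_card (H : Subgroup G) {m : ℕ}
    (hm : 𝔓.ramificationSubgroup G (m + 1) = ⊥) :
    (∑ᶠ (s : H) (_ : s ≠ 1), lowerIndex 𝔓 G (s : G)) + (m + 1 : ℕ) =
      ((∑ i ∈ Finset.range (m + 1), Nat.card (𝔓.ramificationSubgroup H i) : ℕ) : ℕ∞) := by
  have hmH : 𝔓.ramificationSubgroup H (m + 1) = ⊥ := by
    rw [eq_bot_iff]
    intro s hs
    rw [mem_ramificationSubgroup_subgroup_iff, hm, Subgroup.mem_bot] at hs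
    rw [Subgroup.mem_bot]
    exact Subtype.ext hs
  have key := finsum_lowerIndex_ne_one_add_eq_sum_card 𝔓 (G := H) hmH
  simp_rw [lowerIndex_subgroup] at key
  exact key

end LayerCake

/-! ### The integer inequalities of the dévissage -/

section Inequalities

/-- **First inequality** (`Tr`-terms at level `ψ(n) + 1`, any subgroup).  Let `g, h : ℕ → ℕ` with
`h i ≤ g i`, `h i ≤ h 0` for all `i`, and let `m, n, r` with `Σ_{i<m} g (i+1) = r n` and `r = g 0`.
Then `r - h 0 + r n ≤ Σ_{i ≤ m} (g i - h i) + h 0 · m`.  (With `g_i = |G_i|`, `h_i = |H ∩ G_i|`: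
`Σ_{i ≤ m} (g_i - h_i) ≥ (r - h) + r n - m h`.)  In Serre's proof this is the inclusion
`N(U_L^{ψ(n)+1}) ⊆ U_K^{n+1}` of Ch. V §6 Prop. 8, obtained there from the transitivity of `ψ`.
Ref: Serre, *Local Fields*, Ch. V §6, Prop. 8 (proof by dévissage); Ch. IV §3 Prop. 15. [folklore] -/
theorem sub_add_mul_le_sum_sub_add_mul (g h : ℕ → ℕ) (hle : ∀ i, h i ≤ g i)
    (hh0 : ∀ i, h i ≤ h 0) {m n r : ℕ} (hr : r = g 0)
    (hsum : ∑ i ∈ Finset.range m, g (i + 1) = r * n) :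
    r - h 0 + r * n ≤ (∑ i ∈ Finset.range (m + 1), (g i - h i)) + h 0 * m := by
  have key : ∑ i ∈ Finset.range (m + 1), (g i - h i) + ∑ i ∈ Finset.range (m + 1), h i =
      ∑ i ∈ Finset.range (m + 1), g i := by
    rw [← Finset.sum_add_distrib]
    exact Finset.sum_congr rfl fun i _ => Nat.sub_add_cancel (hle i)
  have hg : ∑ i ∈ Finset.range (m + 1), g i = r + r * n := by
    rw [Finset.sum_range_succ', ← hsum, hr, add_comm]
  have hh : ∑ i ∈ Finset.range (m + 1), h i ≤ h 0 + h 0 * m := by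
    rw [Finset.sum_range_succ', add_comm]
    refine Nat.add_le_add_left ?_ _
    calc ∑ i ∈ Finset.range m, h (i + 1) ≤ ∑ _i ∈ Finset.range m, h 0 :=
          Finset.sum_le_sum fun i _ => hh0 (i + 1)
      _ = h 0 * m := by rw [Finset.sum_const, Finset.card_range, smul_eq_mul, mul_comm]
  have h0r : h 0 ≤ r := hr ▸ hle 0
  generalize ∑ i ∈ Finset.range (m + 1), (g i - h i) = A at key ⊢
  generalize ∑ i ∈ Finset.range (m + 1), h i = B at key hh
  generalize ∑ i ∈ Finset.range (m + 1), g i = C at key hg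
  generalize h 0 = h0 at hh h0r ⊢
  omega

/-- **Second inequality** (`Tr`-terms at an integral level `m = ψ(n)` beyond the last jump, for a
proper non-trivial subgroup).  Let `g, h : ℕ → ℕ` be the orders of a decreasing chain of subgroups
`G_i` of a finite group of order `r = g 0` and of `H ∩ G_i` for a subgroup `H` of order `h 0`, so
that: `h (i+1) ∣ h i`, `h i ∣ h 0`, `g j ∣ g i` and `g j ∣ r` for `i ≤ j`, `1 ≤ h i`,
`h i ≤ g i`; assume `1 < h 0 < r` hold in the form `2 ≤ h 0`, and let `μ < m` with `g (μ+1) = 1`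
(so `g i = h i = 1` for `i > μ`), `2 ≤ g μ`, `h m = 1`, and `Σ_{i<m} g (i+1) = r n`.  Then
`h 0 ≤ Σ_{i<m} (h 0 - h (i+1))`.  Proof: if two indices `0 < i ≤ m` have `h i < h 0` each
contributes `≥ h 0 / 2`; otherwise `h i = h 0` for `0 < i < m`, forcing `m = μ + 1` and
`h 0 ∣ g μ`... more precisely `H ≤ G_μ`, and then `Σ_{i<m} g(i+1) = Σ_{i<μ} g(i+1) + 1 ≡ 1 mod g μ`
while `g μ ∣ r n`, a contradiction as `g μ ≥ 2`.  In Serre's proof this is the exactness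
`N(1 + x) ≡ 1 + Tr(x)` at levels beyond the last jump (Ch. V §3 Prop. 5 (iv), §6 Prop. 9 with
`G_{ψ(n)} = 1`), obtained there from the transitivity of `ψ`.
Ref: Serre, *Local Fields*, Ch. V §6, Prop. 9 and Cor. 1–3 (dévissage); Ch. IV §3 Prop. 15. [folklore] -/
theorem le_sum_sub_of_chain (g h : ℕ → ℕ) {r m μ n : ℕ}
    (hanti : ∀ i, h (i + 1) ≤ h i) (hdvd : ∀ i, h (i + 1) ∣ h i)
    (hgdvd : ∀ i j, i ≤ j → g j ∣ g i) (hgr : ∀ i, g i ∣ r)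
    (hhg : ∀ i, h i ≤ g i) (h2 : 2 ≤ h 0)
    (hμm : μ < m) (hgμ1 : ∀ i, μ < i → g i = 1) (hgμ : 2 ≤ g μ) (hhm : h m = 1)
    (hsum : ∑ i ∈ Finset.range m, g (i + 1) = r * n) :
    h 0 ≤ ∑ i ∈ Finset.range m, (h 0 - h (i + 1)) := by
  have hdvd0 : ∀ i, h i ∣ h 0 := fun i => by
    induction i with
    | zero => exact dvd_rfl
    | succ i ih => exact (hdvd i).trans ih
  have hmono : ∀ i j, i ≤ j → h j ≤ h i := by
    intro i j hij
    induction hij with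
    | refl => exact le_rfl
    | step _ ih => exact (hanti _).trans ih
  -- a proper divisor of `h 0` is at most `h 0 / 2`
  have hhalf : ∀ i, h i < h 0 → 2 * h i ≤ h 0 := by
    intro i hi
    obtain ⟨q, hq⟩ := hdvd0 i
    have hq2 : 2 ≤ q := by
      by_contra hlt
      push Not at hlt
      interval_cases q
      · rw [mul_zero] at hq; omega
      · rw [mul_one] at hq; omega
    calc 2 * h i ≤ q * h i := Nat.mul_le_mul_right _ hq2
      _ = h 0 := by rw [mul_comm, ← hq]
  obtain ⟨m', rfl⟩ : ∃ m', m = m' + 1 := ⟨m - 1, by omega⟩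
  by_cases hcase : h m' < h 0
  · -- `m' ≥ 1`; the terms `i + 1 = m'` and `i + 1 = m' + 1` contribute `≥ h 0 / 2` each
    obtain ⟨m'', rfl⟩ : ∃ m'', m' = m'' + 1 := by
      rcases Nat.eq_zero_or_pos m' with h0 | h0
      · subst h0; exact absurd hcase (lt_irrefl _)
      · exact ⟨m' - 1, by omega⟩
    have h1 := hhalf (m'' + 1) hcase
    have h2' := hhalf (m'' + 1 + 1) (by rw [hhm]; omega)
    rw [Finset.sum_range_succ, Finset.sum_range_succ]
    generalize ∑ i ∈ Finset.range m'', (h 0 - h (i + 1)) = A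
    generalize h 0 = h0 at h1 h2' ⊢
    generalize h (m'' + 1) = x at h1 ⊢
    generalize h (m'' + 1 + 1) = y at h2' ⊢
    omega
  · push Not at hcase
    have heq : ∀ i ≤ m', h i = h 0 := fun i hi =>
      le_antisymm (hmono 0 i (Nat.zero_le _)) (hcase.trans (hmono i m' hi))
    -- `h m' = h 0 ≥ 2`, so `g m' ≥ 2`, so `m' ≤ μ`; with `μ < m' + 1`, `m' = μ`
    have hm'μ : m' = μ := by
      have h3 : ¬ μ < m' := fun hlt => by
        have ha := hgμ1 m' hlt
        have hb := hhg m'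
        have hc := heq m' le_rfl
        omega
      omega
    subst hm'μ
    exfalso
    rw [Finset.sum_range_succ, hgμ1 (m' + 1) (by omega)] at hsum
    have hd1 : g m' ∣ ∑ i ∈ Finset.range m', g (i + 1) :=
      Finset.dvd_sum fun i hi => hgdvd (i + 1) m' (by have := Finset.mem_range.mp hi; omega)
    have hd2 : g m' ∣ r * n := (hgr m').mul_right n
    rw [← hsum] at hd2
    have hone : g m' ∣ 1 := (Nat.dvd_add_right hd1).mp hd2
    have := Nat.le_of_dvd one_pos hone
    omega

end Inequalities

end Literature.NumberTheory.GaloisRepresentations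

end
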